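import Mathlib
import Literature.Computability.AlgebraicComplexity.EquivariantDC
import Literature.Computability.AlgebraicComplexity.StandardFamilies
import Literature.Computability.AlgebraicComplexity.LandsbergRessayreNormalForm
import Literature.Computability.AlgebraicComplexity.LandsbergRessayreProofs
import Literature.Computability.AlgebraicComplexity.LRLiftCharacter
import Literature.Computability.AlgebraicComplexity.LRFullLifts
import Literature.Computability.AlgebraicComplexity.LRPencilOfMatrix
import Literature.Computability.AlgebraicComplexity.LR21Datum
import Literature.Computability.AlgebraicComplexity.GenericTorusGrading
import Literature.Computability.AlgebraicComplexity.DetReprEquivalent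
import Literature.Computability.AlgebraicComplexity.VonZurGathenSingPermHeight
import Summits.ValiantsHypothesis.ValiantsHypothesis.Theorems.RigidityForcesSymmetryRankRigidMinimalReprTiedTorusDefs
import Summits.ValiantsHypothesis.ValiantsHypothesis.Theorems.RigidityForcesSymmetryPairTiedTorusBoundDefs
import Summits.ValiantsHypothesis.ValiantsHypothesis.Theorems.RigidityForcesSymmetryRankRigidMinimalReprPathExpansion
import Summits.ValiantsHypothesis.ValiantsHypothesis.Theorems.RigidityForcesSymmetryRankRigidMinimalReprSpectralGauge
import Summits.ValiantsHypothesis.ValiantsHypothesis.Theorems.RigidityForcesSymmetryRankRigidMinimalReprLevelNodes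

/-!
# Crux `RankRigidMinimalRepr` (stmt-ValiantsHypothesis-18034), line `PairTiedTorusBound` —
# the REGISTERED dictionary stub `stub_levelDecomp` (typed level decompositions from a tied-torus-equivariant
# affine determinantal representation of the permanent)

Route `ValiantsHypothesis/RigidityForcesSymmetry`, crux `RankRigidMinimalRepr` (stmt-ValiantsHypothesis-18034), registered
skeleton `Cruxes/RankRigidMinimalRepr/Lines/PairTiedTorusBound.lean` (stubs `stub_levelDecomp`, `stub_levelBound`; the
latter landed as `…RankRigidMinimalReprStubLevelBound.lean`).  This file proves `stub_levelDecomp` with the REGISTERED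
signature, over the tree copies `tiedTorus` (`…RankRigidMinimalReprTiedTorusDefs.lean`) and `TiedLevelDecomposable`
(`…PairTiedTorusBoundDefs.lean`) of the workfile's objects (verbatim copies; `Theorems/` cannot import `Cruxes/`).
Convention of the tree's LR17 files: `m` = size of the permanent, `n` = size of the matrix.

**Statement.**  For `m ≥ 3` and every `k`, a `tiedTorus m k`-equivariant (exact lifts, `IsEquivariantDetRepr`) affine
determinantal representation `A` of `perm_m` of size `n` yields `w : ℕ → ℕ` with `1 + Σ_{s=1}^{m-1} w s ≤ n` and, for
every `1 ≤ s ≤ m - 1`, a level-`s` typed decomposition of `perm_m` with `w s` products (`TiedLevelDecomposable m k s (w s)`).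

**Proof (the dictionary, elementary).**
1. Regularity `rank A(0) = n - 1` (von zur Gathen 1987, tree theorem `vonzurGathen1987_perm_detRepr_rank_holds`).
2. ONE generic element of the tied torus: row `i` scaled by the prime `p_i = primes₂ (inl i)`, column `j` by
   `q_{tc j}` (`tc j = 0` if `j ≤ k` is tied, `tc j = j` otherwise) — it lies in `tiedTorusGen m k` — and its exact lift
   `(P, Q)`: `P Λ = Λ Q`, `P A_{ij} = p_i q_{tc j} A_{ij} Q`.
3. The spectral gauge (`SpectralGauge.exists_spectral_gauge`): constant invertible `g, h` with `(g A h)(0) = Λ_{i₀}` and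
   weight-graded coefficient matrices; the kernel weight `γ₀ = θ i₀ ≠ 0` and the top weight
   `ρ i₀ = (∏ p ∏ q_{tc}) γ₀` (`LRPencil.maxGenEigenspace_le_range_of_ne_character`).  Equivariance is then dropped.
4. The path expansion of `g A h` in this gauge (`PathExpansion.neg_dotProduct_pow_mulVec_eq_of_constPart_eq_lamMatrix`,
   = Chatterjee–Kumar–Volk 2024 Thm. 13 with the normal form given): `-bᵀ D^{m-2} c = κ perm_m`, `κ = det g det h ≠ 0`,
   with `b, c, D` the explicit blocks of the linear part around `i₀`; their supports are weight-graded
   (`WeightTyping.carries_homogeneousComponent_one`).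
5. Level nodes (`LevelNodes.levelDecomp_of_graded_path_expansion`): at each level `s` the good nodes give a typed
   decomposition (unique factorisation of the tied-torus weights), and a node is good at one level only.

HONEST FRAMING: this is ONE registered stub (the dictionary) of a FORWARD RUNG (`PairTiedTorusBound = TiedTorusBound 1`,
and `TiedTorusBound 2` via `…TiedTorusBoundOfLevelDecomp.lean`) inside one route; the crux `RankRigidMinimalRepr`
(stmt-18034) itself stays OPEN and is calibrated equal to the route's target (`Cruxes/…/CruxCalibration.lean`);
census-neutral; `VP ≠ VNP` is NOT proved and nothing here is progress on it.
-/

set_option autoImplicit false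

-- the mandated summit-side namespace repeats a component by design (single-problem summit)
set_option linter.dupNamespace false

noncomputable section

open Matrix MvPolynomial Finset Module.End
open scoped Kronecker
open Literature.Computability.AlgebraicComplexity LRPencil
open Summit.ValiantsHypothesis.ValiantsHypothesis.Theorems.RigidityForcesSymmetryPairTiedTorusBound

namespace Summit.ValiantsHypothesis.ValiantsHypothesis.Theorems.RigidityForcesSymmetryRankRigidMinimalRepr

/-- **Registered stub `stub_levelDecomp` of line `PairTiedTorusBound` (crux stmt-ValiantsHypothesis-18034) — the
dictionary.**  A `tiedTorus m k`-equivariant (exact lifts) affine determinantal representation of `perm_m` (`m ≥ 3`) of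
size `n` yields, for every level `1 ≤ s ≤ m - 1`, a level-`s` typed decomposition of `perm_m` with `w s` products, where
`1 + Σ_{s=1}^{m-1} w s ≤ n`.  (Regularity ⇒ normal form `Λ_{i₀}` in generalised-eigenspace adapted bases of the exact lift
of ONE generic tied-torus element; path expansion `-bᵀ D^{m-2} c = κ perm_m` with weight-graded blocks; typing of the
nodes by unique factorisation; a node lives at one level.) [cite: LandsbergRessayre2017, §3, §6]
[cite: Vonzurgathen1987, Thm. 3.1] [cite: ChatterjeeKumarVolk2024, Thm. 13] -/
theorem stub_levelDecomp :
    ∀ m k : ℕ, 3 ≤ m → ∀ (n : ℕ) (A : Matrix (Fin n) (Fin n) (MvPolynomial (Fin m × Fin m) ℂ)),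
      IsEquivariantDetRepr (tiedTorus m k) (perPoly (Fin m) ℂ) A →
        ∃ w : ℕ → ℕ, (∑ s ∈ Finset.range (m - 1), w (s + 1)) + 1 ≤ n ∧
          ∀ s : ℕ, 1 ≤ s → s + 1 ≤ m → TiedLevelDecomposable m k s (w s) := by
  intro m₀ k hm₀ n₀ A hA
  classical
  -- `m₀ = m + 1` (so that column `0` exists) and `n₀ = n + 1` (a representation of `perm` has positive size)
  obtain ⟨m, rfl⟩ : ∃ m, m₀ = m + 1 := ⟨m₀ - 1, by omega⟩
  have haff : ∀ r c, (A r c).totalDegree ≤ 1 := hA.1.1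
  have hdet : A.det = perPoly (Fin (m + 1)) ℂ := hA.1.2
  have hn₀ : 0 < n₀ := pos_of_det_eq_perPoly (by omega) hdet
  have hreg : IsRegularDetRepr (perPoly (Fin (m + 1)) ℂ) A :=
    hA.isRegular_perPoly vonzurGathen1987_perm_detRepr_rank_holds hm₀
  have hrank : (constPart A).rank = n₀ - 1 := hreg.2
  -- (2) the generic tied-torus element: rows `p_i`, columns `q_{tc j}`
  set r : Fin (m + 1) ⊕ Fin (m + 1) → ℕ := primes₂ (m + 1) with hr
  set d : Fin (m + 1) → ℂ := fun i => (r (Sum.inl i) : ℂ) with hd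
  set e : Fin (m + 1) → ℂ := fun j => (r (Sum.inr (if j.val ≤ k then 0 else j)) : ℂ) with he
  have hd0 : ∀ i, d i ≠ 0 := fun i => primes₂_cast_ne_zero (m + 1) _
  have he0 : ∀ j, e j ≠ 0 := fun j => primes₂_cast_ne_zero (m + 1) _
  let γ : GL (Fin (m + 1) × Fin (m + 1)) ℂ :=
    Matrix.GeneralLinearGroup.kronecker (diagUnit ℂ d hd0) (diagUnit ℂ e he0)
  have hγcoe : (γ : Matrix (Fin (m + 1) × Fin (m + 1)) (Fin (m + 1) × Fin (m + 1)) ℂ) =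
      Matrix.diagonal d ⊗ₖ Matrix.diagonal e :=
    coe_kronecker_diagUnit d e hd0 he0
  have hγmem : γ ∈ tiedTorus (m + 1) k := by
    refine Subgroup.subset_closure ⟨d, e, fun j j' hj hj' => ?_, ?_⟩
    · simp only [he, if_pos hj, if_pos hj']
    · rw [hγcoe, Matrix.diagonal_kronecker_diagonal]
  -- its exact lift `(P, Q)`
  obtain ⟨P, Q, hPQ, hΛ⟩ := hA.exists_lift_stabilising hγmem
  have hkj : ∀ v : Fin (m + 1) × Fin (m + 1), (P : Matrix (Fin n₀) (Fin n₀) ℂ) * coeffMat A v =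
      (d v.1 * e v.2) • (coeffMat A v * (Q : Matrix (Fin n₀) (Fin n₀) ℂ)) := by
    intro v
    have e1 : coeffMat (Matrix.linSubstEntries γ A) v =
        coeffMat ((P : Matrix (Fin n₀) (Fin n₀) ℂ).map C * A *
          ((Q⁻¹ : GL (Fin n₀) ℂ) : Matrix (Fin n₀) (Fin n₀) ℂ).map C) v := by rw [hPQ]
    rw [coeffMat_linSubstEntries _ _ haff, hγcoe, sum_kron_diagonal_diagonal_smul,
      coeffMat_C_mul_mul_C] at e1
    rw [mul_eq_of_eq_mul_mul_inv e1, Matrix.smul_mul]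
  -- (3) the spectral gauge
  obtain ⟨g, h, θ, ρ, i₀, hgU, hhU, hgΛh, hgrade, hρθ, hker, htop⟩ :=
    SpectralGauge.exists_spectral_gauge hn₀ (constPart A) (fun v => coeffMat A v) (fun v => d v.1 * e v.2)
      (P : Matrix (Fin n₀) (Fin n₀) ℂ) (Q : Matrix (Fin n₀) (Fin n₀) ℂ) hΛ hkj hrank
  -- the kernel weight `γ₀ = θ i₀` is non-zero (`Q` is invertible) and the top weight is the character
  have hγ₀ : θ i₀ ≠ 0 := by
    intro h0
    have hQinj : Function.Injective (Matrix.toLin' (Q : Matrix (Fin n₀) (Fin n₀) ℂ)) := fun x y hxy =>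
      (Matrix.mulVec_injective_iff_isUnit.2 (Units.isUnit Q)) (by simpa only [Matrix.toLin'_apply] using hxy)
    have hbot := maxGenEigenspace_zero_eq_bot_of_injective _ hQinj
    rw [h0, hbot, le_bot_iff] at hker
    have hK := finrank_ker_toLin'_eq_one hn₀ hrank
    rw [hker, finrank_bot] at hK
    exact zero_ne_one hK
  have hβ : ρ i₀ = ((∏ i, d i) * ∏ j, e j) * θ i₀ := by
    by_contra hne
    exact htop (maxGenEigenspace_le_range_of_ne_character hn₀ hdet hrank hγcoe hPQ hker (ρ i₀) hne)
  -- (4) the gauged matrix `M = g A h`: affine, `det M = κ perm`, `M(0) = Λ_{i₀}`, graded coefficient matrices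
  obtain ⟨n, rfl⟩ : ∃ n, n₀ = n + 1 := ⟨n₀ - 1, by omega⟩
  set M : Matrix (Fin (n + 1)) (Fin (n + 1)) (MvPolynomial (Fin (m + 1) × Fin (m + 1)) ℂ) :=
    g.map C * A * h.map C with hM
  have hMdeg : ∀ x y, (M x y).totalDegree ≤ 1 := fun x y => totalDegree_map_C_mul_mul_map_C_le g h haff x y
  have hMdet : M.det = C (g.det * h.det) * perPoly (Fin (m + 1)) ℂ := by
    rw [hM, det_map_C_mul_mul_map_C, hdet]
  have hM0 : constPart M = lamMatrix ℂ i₀ := by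
    rw [hM, constPart_mul, constPart_mul, constPart_map_C, constPart_map_C, hgΛh]
  have hκ : g.det * h.det ≠ 0 :=
    mul_ne_zero ((Matrix.isUnit_iff_isUnit_det g).1 hgU).ne_zero ((Matrix.isUnit_iff_isUnit_det h).1 hhU).ne_zero
  have hMw : ∀ (x y : Fin (n + 1)) (u : Fin (m + 1) × Fin (m + 1)),
      coeff (Finsupp.single u 1) (M x y) ≠ 0 → (d u.1 * e u.2) * θ y = ρ x := by
    intro x y u hu
    rw [← coeffMat_apply, hM, coeffMat_C_mul_mul_C] at hu
    exact (hgrade u x y hu).symm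
  -- (5) the path expansion in this gauge
  have hperm : (perPoly (Fin (m + 1)) ℂ).IsHomogeneous (m + 1) := by
    simpa [Fintype.card_fin] using perPoly_isHomogeneous (n := Fin (m + 1)) (k := ℂ)
  obtain ⟨hpath, -⟩ := PathExpansion.neg_dotProduct_pow_mulVec_eq_of_constPart_eq_lamMatrix
    (perPoly (Fin (m + 1)) ℂ) (m + 1) hperm (by omega) M hMdeg (g.det * h.det) hMdet i₀ hM0
  -- the blocks `b, c, D` of the linear part of `M` around `i₀` and their weights
  set b : Fin n → MvPolynomial (Fin (m + 1) × Fin (m + 1)) ℂ :=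
    fun j => homogeneousComponent 1 (M i₀ (i₀.succAbove j)) with hb
  set c : Fin n → MvPolynomial (Fin (m + 1) × Fin (m + 1)) ℂ :=
    fun j => homogeneousComponent 1 (M (i₀.succAbove j) i₀) with hc
  set D : Matrix (Fin n) (Fin n) (MvPolynomial (Fin (m + 1) × Fin (m + 1)) ℂ) :=
    Matrix.of fun j l => -homogeneousComponent 1 (M (i₀.succAbove j) (i₀.succAbove l)) with hD
  set wv : Fin (m + 1) × Fin (m + 1) → ℂ := fun v => ((primes₂ (m + 1) (Sum.inl v.1) : ℂ) *
    (primes₂ (m + 1) (Sum.inr (if v.2.val ≤ k then 0 else v.2)) : ℂ)) with hwv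
  have hdw : ∀ u : Fin (m + 1) × Fin (m + 1), d u.1 * e u.2 = wv u := fun u => rfl
  set θ' : Fin n → ℂ := fun j => θ (i₀.succAbove j) with hθ'
  have hρθ' : ∀ j, ρ (i₀.succAbove j) = θ' j := fun j => hρθ _ (Fin.succAbove_ne i₀ j)
  have hbw : ∀ s, ∀ δ ∈ (b s).support, (∏ v, wv v ^ δ v) * θ' s =
      ((∏ i : Fin (m + 1), (primes₂ (m + 1) (Sum.inl i) : ℂ)) *
        ∏ j : Fin (m + 1), (primes₂ (m + 1) (Sum.inr (if j.val ≤ k then 0 else j)) : ℂ)) * θ i₀ := by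
    intro s
    have h1 := WeightTyping.carries_homogeneousComponent_one wv (p := M i₀ (i₀.succAbove s))
      (a := θ' s) (b := ρ i₀) (fun u hu => by rw [← hdw]; exact hMw _ _ u hu)
    intro δ hδ
    rw [h1 δ hδ, hβ]
  have hcw : ∀ j, ∀ δ ∈ (c j).support, (∏ v, wv v ^ δ v) * θ i₀ = θ' j := fun j =>
    WeightTyping.carries_homogeneousComponent_one wv (p := M (i₀.succAbove j) i₀)
      (a := θ i₀) (b := θ' j) (fun u hu => by rw [← hdw, ← hρθ' j]; exact hMw _ _ u hu)
  have hDw : ∀ j l, ∀ δ ∈ (D j l).support, (∏ v, wv v ^ δ v) * θ' l = θ' j := fun j l => by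
    rw [hD, Matrix.of_apply]
    exact WeightTyping.carries_neg wv (WeightTyping.carries_homogeneousComponent_one wv
      (p := M (i₀.succAbove j) (i₀.succAbove l)) (a := θ' l) (b := θ' j)
      (fun u hu => by rw [← hdw, ← hρθ' j]; exact hMw _ _ u hu))
  have hbh : ∀ j, (b j).IsHomogeneous 1 := fun j => homogeneousComponent_isHomogeneous 1 _
  have hDh : ∀ j l, (D j l).IsHomogeneous 1 := fun j l => by
    rw [hD, Matrix.of_apply]; exact (homogeneousComponent_isHomogeneous 1 _).neg
  -- (6) the level nodes
  obtain ⟨w, hcount, hdec⟩ := LevelNodes.levelDecomp_of_graded_path_expansion k b c D hbh hDh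
    (g.det * h.det) hκ hpath θ' (θ i₀) hγ₀ hbw hcw hDw
  refine ⟨w, ?_, hdec⟩
  rw [Nat.add_sub_cancel]
  exact hcount

end Summit.ValiantsHypothesis.ValiantsHypothesis.Theorems.RigidityForcesSymmetryRankRigidMinimalRepr

end
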